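import Summits.PneNP.PneNP.Theorems.BruckRyserSosSosBlindPlanesIdentities
import Summits.PneNP.PneNP.Theorems.BruckRyserSosSosBlindPlanesTemplateSum

/-!
# PneNP / BruckRyserSos — genuine moments: planes of prime order

Route `PneNP/BruckRyserSos`, crux stmt-PneNP-16761 (`SosBlindPlanes`), seventh file.

At a PRIME order `n = p` a projective plane exists (`PG(2,p)`, Mathlib's
`Configuration.ofField`), and the uniform distribution over its relabelings by the board symmetry
group is a genuine probability measure on `0/1` boards satisfying every design identity exactly.
Its moments give a table for which all the constraints of the transfer formula hold:

* `IsPlaneInc n Inc` — an incidence set on the `v × v` board with row/column sums `n + 1` and the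
  `λ = 1` conditions; `exists_isPlaneInc_prime` — one exists on the board of size
  `v = p² + p + 1` for every prime `p`;
* `dens Inc U` — the probability that a uniformly relabeled copy of `U` lies inside `Inc`;
  it is board-invariant (`boardInv_dens`), `dens ∅ = 1`, and it satisfies the board identities
  `Σ_B dens (U ∪ A × {B}) = r · dens U` (`sum_dens_addLine_one/two`, columns by transposing);
* `genTable` — its restriction to templates, an invariant table whose template moments ARE the
  densities (`tmom_genTable`), so that its moment matrix is `|G|⁻¹ · Z Zᵀ ⪰ 0`
  (`momMatrix_genTable_posSemidef`).

References: folklore (orbit averaging gives pseudoexpectations of every degree, cf.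
Kothari–Mori–O'Donnell–Witmer 2017 §2.3); P. Dembowski, *Finite Geometries* (1968), §3.2
(`PG(2,q)`).
-/

set_option linter.dupNamespace false -- `Summit.PneNP.PneNP.…`: summit = sub-problem name (D-0017 single-conjunct layout)

noncomputable section

namespace Summit.PneNP.PneNP.Theorems.SosBlindPlanes

open Finset Function Matrix

variable {v D : ℕ}

/-! ### Plane incidences on a board -/

/-- An incidence set on the `v × v` board is a PLANE INCIDENCE of order `n`: every point is on
`n + 1` lines, every line has `n + 1` points, two distinct points are on exactly one common line,
two distinct lines have exactly one common point. [Dembowski 1968, §3.2] [folklore] -/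
structure IsPlaneInc (n : ℕ) (Inc : Finset (Fin v × Fin v)) : Prop where
  row : ∀ p : Fin v, (univ.filter fun B => (p, B) ∈ Inc).card = n + 1
  col : ∀ B : Fin v, (univ.filter fun p => (p, B) ∈ Inc).card = n + 1
  rowPair : ∀ p p' : Fin v, p ≠ p' →
    (univ.filter fun B => (p, B) ∈ Inc ∧ (p', B) ∈ Inc).card = 1
  colPair : ∀ B B' : Fin v, B ≠ B' →
    (univ.filter fun p => (p, B) ∈ Inc ∧ (p, B') ∈ Inc).card = 1

/-- The transpose of a plane incidence is a plane incidence. [folklore] -/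
theorem IsPlaneInc.swapC {n : ℕ} {Inc : Finset (Fin v × Fin v)} (h : IsPlaneInc n Inc) :
    IsPlaneInc n (swapC Inc) where
  row p := by simpa [mem_swapC] using h.col p
  col B := by simpa [mem_swapC] using h.row B
  rowPair p p' hp := by simpa [mem_swapC] using h.colPair p p' hp
  colPair B B' hB := by simpa [mem_swapC] using h.rowPair B B' hB

/-! ### Densities -/

/-- Indicator that the relabeling of `U` by `g` lies inside `Inc`. [folklore] -/
def indic (Inc U : Finset (Fin v × Fin v)) (g : Equiv.Perm (Fin v) × Equiv.Perm (Fin v)) : ℝ :=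
  if rel g.1 g.2 U ⊆ Inc then 1 else 0

/-- The DENSITY of `U` in `Inc`: the probability that a uniformly random relabeling of `U` by the
board symmetry group lies inside `Inc`. [folklore] -/
def dens (Inc U : Finset (Fin v × Fin v)) : ℝ :=
  (∑ g : Equiv.Perm (Fin v) × Equiv.Perm (Fin v), indic Inc U g) /
    Fintype.card (Equiv.Perm (Fin v) × Equiv.Perm (Fin v))

/-- The indicator of a relabeled configuration. [folklore] -/
theorem indic_rel (Inc U : Finset (Fin v × Fin v)) (σ τ : Equiv.Perm (Fin v))
    (g : Equiv.Perm (Fin v) × Equiv.Perm (Fin v)) :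
    indic Inc (rel σ τ U) g = indic Inc U (g * (σ, τ)) := by
  simp only [indic, rel_rel]
  rfl

/-- Densities are invariant under the board symmetry group. [folklore] -/
theorem boardInv_dens (Inc : Finset (Fin v × Fin v)) : BoardInv (dens Inc) := by
  intro σ τ U
  simp only [dens, indic_rel]
  congr 1
  exact Equiv.sum_comp (Equiv.mulRight (σ, τ)) (indic Inc U)

/-- The empty configuration has density `1`. [folklore] -/
theorem dens_empty (Inc : Finset (Fin v × Fin v)) : dens Inc ∅ = 1 := by
  simp only [dens, indic, rel_empty, empty_subset, if_true, sum_const, card_univ, nsmul_eq_mul,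
    mul_one]
  exact div_self (Nat.cast_ne_zero.2 Fintype.card_ne_zero)

/-- Densities of transposed configurations. [folklore] -/
theorem dens_swapC (Inc U : Finset (Fin v × Fin v)) : dens Inc (swapC U) = dens (swapC Inc) U := by
  simp only [dens]
  congr 1
  rw [← Equiv.sum_comp (Equiv.prodComm (Equiv.Perm (Fin v)) (Equiv.Perm (Fin v)))]
  refine sum_congr rfl fun g _ => ?_
  simp only [indic, Equiv.prodComm_apply, Prod.fst_swap, Prod.snd_swap]
  have : rel g.2 g.1 (swapC U) ⊆ Inc ↔ rel g.1 g.2 U ⊆ swapC Inc := by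
    rw [← swapC_rel]
    constructor
    · intro h c hc
      have : (c.2, c.1) ∈ swapC (rel g.1 g.2 U) := mem_swapC.2 (by simpa using hc)
      exact mem_swapC.2 (h this)
    · intro h c hc
      have h1 := h (mem_swapC.1 hc)
      exact mem_swapC.1 h1
  simp only [this]

/-- The relabeled `addLine U A B` lies in `Inc` iff the relabeled `U` does and the new cells do.
[folklore] -/
theorem rel_addLine_subset_iff (Inc U : Finset (Fin v × Fin v)) (A : Finset (Fin v)) (B : Fin v)
    (g : Equiv.Perm (Fin v) × Equiv.Perm (Fin v)) :
    rel g.1 g.2 (addLine U A B) ⊆ Inc ↔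
      rel g.1 g.2 U ⊆ Inc ∧ ∀ a ∈ A, (g.1 a, g.2 B) ∈ Inc := by
  rw [rel_addLine, addLine, union_subset_iff]
  refine and_congr Iff.rfl ?_
  constructor
  · intro h a ha
    exact h (mem_product.2 ⟨mem_image_of_mem _ ha, mem_singleton_self _⟩)
  · intro h c hc
    obtain ⟨h1, h2⟩ := mem_product.1 hc
    obtain ⟨a, ha, hac⟩ := mem_image.1 h1
    rw [mem_singleton] at h2
    have : c = (g.1 a, g.2 B) := Prod.ext hac.symm h2
    rw [this]; exact h a ha

/-- **Sum of densities over the added line.** `Σ_B dens (U ∪ A × {B})` equals the average over `g`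
of `[g U ⊆ Inc] · #{B' : (g a, B') ∈ Inc ∀ a ∈ A}`. [folklore] -/
theorem sum_dens_addLine (Inc U : Finset (Fin v × Fin v)) (A : Finset (Fin v)) :
    ∑ B : Fin v, dens Inc (addLine U A B) =
      (∑ g : Equiv.Perm (Fin v) × Equiv.Perm (Fin v),
        indic Inc U g * ((univ.filter fun B' : Fin v => ∀ a ∈ A, (g.1 a, B') ∈ Inc).card : ℝ)) /
        Fintype.card (Equiv.Perm (Fin v) × Equiv.Perm (Fin v)) := by
  classical
  simp only [dens, ← Finset.sum_div]
  congr 1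
  rw [sum_comm]
  refine sum_congr rfl fun g _ => ?_
  have h1 : ∀ B : Fin v, indic Inc (addLine U A B) g =
      indic Inc U g * (if ∀ a ∈ A, (g.1 a, g.2 B) ∈ Inc then 1 else 0) := by
    intro B
    simp only [indic, rel_addLine_subset_iff]
    by_cases hU : rel g.1 g.2 U ⊆ Inc
    · simp [hU]
    · simp [hU]
  simp only [h1, ← Finset.mul_sum]
  congr 1
  rw [← Equiv.sum_comp g.2⁻¹ (fun B => if ∀ a ∈ A, (g.1 a, g.2 B) ∈ Inc then (1 : ℝ) else 0)]
  simp only [Equiv.Perm.coe_inv, Equiv.apply_symm_apply, sum_boole]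

/-- **Row-sum identity for densities**: `Σ_B dens (U ∪ {p} × {B}) = (n + 1) · dens U`.
[folklore] -/
theorem sum_dens_addLine_one {n : ℕ} {Inc : Finset (Fin v × Fin v)} (hInc : IsPlaneInc n Inc)
    (U : Finset (Fin v × Fin v)) (A : Finset (Fin v)) (hA : A.card = 1) :
    ∑ B : Fin v, dens Inc (addLine U A B) = ((n : ℝ) + 1) * dens Inc U := by
  obtain ⟨p, rfl⟩ := card_eq_one.1 hA
  rw [sum_dens_addLine, dens, mul_div_assoc', Finset.mul_sum]
  congr 1
  refine sum_congr rfl fun g _ => ?_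
  have : (univ.filter fun B' : Fin v => ∀ a ∈ ({p} : Finset (Fin v)), (g.1 a, B') ∈ Inc).card =
      n + 1 := by
    simpa using hInc.row (g.1 p)
  rw [this, mul_comm]
  push_cast
  ring

/-- **Row inner-product identity for densities**: `Σ_B dens (U ∪ {p, p'} × {B}) = dens U` for
`p ≠ p'`. [folklore] -/
theorem sum_dens_addLine_two {n : ℕ} {Inc : Finset (Fin v × Fin v)} (hInc : IsPlaneInc n Inc)
    (U : Finset (Fin v × Fin v)) (A : Finset (Fin v)) (hA : A.card = 2) :
    ∑ B : Fin v, dens Inc (addLine U A B) = 1 * dens Inc U := by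
  obtain ⟨p, p', hpp', rfl⟩ := card_eq_two.1 hA
  rw [sum_dens_addLine, dens, one_mul]
  congr 1
  refine sum_congr rfl fun g _ => ?_
  have : (univ.filter fun B' : Fin v => ∀ a ∈ ({p, p'} : Finset (Fin v)), (g.1 a, B') ∈ Inc).card
      = 1 := by
    have h := hInc.rowPair (g.1 p) (g.1 p') (fun h => hpp' (g.1.injective h))
    simpa using h
  rw [this]
  simp

/-- Densities satisfy the template row identities of every size bound. [folklore] -/
theorem rowIdentity_dens {n : ℕ} {Inc : Finset (Fin v × Fin v)} (hInc : IsPlaneInc n Inc)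
    (hDv : D ≤ v) (dk : ℕ) {k : ℕ} {r : ℝ} (hk : k = 1 ∧ r = (n : ℝ) + 1 ∨ k = 2 ∧ r = 1) :
    RowIdentity D v dk k r fun W => dens Inc (rel (emb hDv) (emb hDv) W) := by
  intro τ₀ A₀ Bs _ hA hBs
  rw [← sum_addLine_emb (boardInv_dens Inc) hDv τ₀ A₀ hBs]
  rcases hk with ⟨rfl, rfl⟩ | ⟨rfl, rfl⟩
  · exact sum_dens_addLine_one hInc _ _ (by rw [card_image_of_injective _ (emb_injective hDv), hA])
  · exact sum_dens_addLine_two hInc _ _ (by rw [card_image_of_injective _ (emb_injective hDv), hA])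

/-- Densities satisfy the template row identities of the transposed table (the column identities).
[folklore] -/
theorem rowIdentity_dens_swapC {n : ℕ} {Inc : Finset (Fin v × Fin v)} (hInc : IsPlaneInc n Inc)
    (hDv : D ≤ v) (dk : ℕ) {k : ℕ} {r : ℝ} (hk : k = 1 ∧ r = (n : ℝ) + 1 ∨ k = 2 ∧ r = 1) :
    RowIdentity D v dk k r fun W => dens Inc (rel (emb hDv) (emb hDv) (swapC W)) := by
  have h := rowIdentity_dens hInc.swapC hDv dk hk
  intro τ₀ A₀ Bs h1 h2 h3
  have h' := h τ₀ A₀ Bs h1 h2 h3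
  simp only [← dens_swapC, swapC_rel] at h'
  exact h'

/-! ### The genuine table -/

/-- The GENUINE TABLE of a plane incidence: densities of embedded templates. [folklore] -/
def genTable (hDv : D ≤ v) (Inc : Finset (Fin v × Fin v)) : Finset (Fin D × Fin D) → ℝ :=
  fun W => dens Inc (rel (emb hDv) (emb hDv) W)

/-- The genuine table is invariant. [folklore] -/
theorem tabInv_genTable (hDv : D ≤ v) (Inc : Finset (Fin v × Fin v)) : TabInv (genTable hDv Inc) := by
  intro α β W
  simp only [genTable, rel_rel]
  have hι := emb_injective hDv
  obtain ⟨σ, τ, hστ⟩ := exists_perm_rel_eq W (f := emb hDv) (f' := emb hDv ∘ α) (g := emb hDv)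
    (g' := emb hDv ∘ β) hι.injOn (hι.comp α.injective).injOn hι.injOn (hι.comp β.injective).injOn
  rw [← hστ, boardInv_dens]

/-- The genuine table of the empty template is `1`. [folklore] -/
theorem genTable_empty (hDv : D ≤ v) (Inc : Finset (Fin v × Fin v)) : genTable hDv Inc ∅ = 1 := by
  simp [genTable, dens_empty]

/-- **Template moments of the genuine table are densities** (for configurations with at most
`D` points and `D` lines). [folklore] -/
theorem tmom_genTable (hD : 0 < D) (hDv : D ≤ v) (Inc : Finset (Fin v × Fin v))
    {U : Finset (Fin v × Fin v)} (hP : (pts U).card ≤ D) (hL : (lns U).card ≤ D) :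
    tmom D (genTable hDv Inc) U = dens Inc U := by
  rw [tmom_of_le hP hL]
  obtain ⟨f, g, hf, hg, hc⟩ := canon_spec hD hP hL
  rw [hc, genTable, rel_rel]
  have hι := emb_injective hDv
  obtain ⟨σ, τ, hστ⟩ := exists_perm_rel_eq U (f := id) (f' := emb hDv ∘ f) (g := id)
    (g' := emb hDv ∘ g) (Set.injOn_id _) (hι.comp_injOn hf) (Set.injOn_id _) (hι.comp_injOn hg)
  rw [← hστ, rel_id, boardInv_dens]

/-- The moment matrix of the genuine table is `|G|⁻¹ Z Zᵀ`, hence positive semidefinite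
(`2h ≤ D ≤ v`). [Kothari–Mori–O'Donnell–Witmer 2017, §2.3] [folklore] -/
theorem momMatrix_genTable_posSemidef {h : ℕ} (hD : 0 < D) (hDv : D ≤ v) (h2 : 2 * h ≤ D)
    (Inc : Finset (Fin v × Fin v)) : (momMatrix v D h (genTable hDv Inc)).PosSemidef := by
  classical
  set Z : Matrix (Idx v h) (Equiv.Perm (Fin v) × Equiv.Perm (Fin v)) ℝ :=
    fun S g => indic Inc S.1 g with hZ
  have hM : momMatrix v D h (genTable hDv Inc) =
      (Fintype.card (Equiv.Perm (Fin v) × Equiv.Perm (Fin v)) : ℝ)⁻¹ • (Z * Zᴴ) := by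
    ext S T
    have hP : (pts (S.1 ∪ T.1)).card ≤ D := by
      refine (card_pts_le _).trans ((card_union_le _ _).trans ?_)
      have := S.2; have := T.2; omega
    have hL : (lns (S.1 ∪ T.1)).card ≤ D := by
      refine (card_lns_le _).trans ((card_union_le _ _).trans ?_)
      have := S.2; have := T.2; omega
    rw [momMatrix_apply, tmom_genTable hD hDv Inc hP hL, dens, Matrix.smul_apply, Matrix.mul_apply,
      smul_eq_mul, div_eq_inv_mul]
    congr 1
    refine sum_congr rfl fun g _ => ?_
    simp only [hZ, conjTranspose_apply, star_trivial, indic, rel_union, union_subset_iff]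
    by_cases h1 : rel g.1 g.2 S.1 ⊆ Inc <;> by_cases h2 : rel g.1 g.2 T.1 ⊆ Inc <;> simp [h1, h2]
  rw [hM]
  exact (Matrix.posSemidef_self_mul_conjTranspose Z).smul (by positivity)

/-! ### Planes of prime order -/

section Prime

open Configuration
open scoped LinearAlgebra.Projectivization

/-- **For every prime `p` the board of size `p² + p + 1` carries a plane incidence of order `p`**
(the projective plane over `𝔽_p`). [Dembowski 1968, §3.2] [folklore] -/
theorem exists_isPlaneInc_prime (p : ℕ) (hp : p.Prime) :
    ∃ Inc : Finset (Fin (p ^ 2 + p + 1) × Fin (p ^ 2 + p + 1)), IsPlaneInc p Inc := by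
  classical
  haveI : Fact p.Prime := ⟨hp⟩
  let P := ℙ (ZMod p) (Fin 3 → ZMod p)
  haveI : Fintype P := Fintype.ofFinite P
  -- the order of the plane is `p`
  have hcardP : Fintype.card P = p ^ 2 + p + 1 := by
    rw [Fintype.card_eq_nat_card,
      Projectivization.card_of_finrank (ZMod p) (Fin 3 → ZMod p) (Module.finrank_fin_fun _),
      Nat.card_zmod]
    simp [Finset.sum_range_succ]
    ring
  have horder : ProjectivePlane.order P P = p := by
    have h := ProjectivePlane.card_points P P
    rw [hcardP] at h
    have hmono : StrictMono fun t : ℕ => t ^ 2 + t + 1 := by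
      intro a b hab
      have : a ^ 2 ≤ b ^ 2 := Nat.pow_le_pow_left hab.le 2
      dsimp only
      omega
    exact (hmono.injective h).symm
  set e : Fin (p ^ 2 + p + 1) ≃ P := (Fintype.equivFinOfCardEq hcardP).symm with he
  refine ⟨univ.filter fun c => e c.1 ∈ e c.2, ?_, ?_, ?_, ?_⟩
  · intro q
    have h := ProjectivePlane.lineCount_eq (P := P) P (e q)
    rw [horder, Configuration.lineCount, Nat.card_eq_fintype_card, Fintype.card_subtype] at h
    rw [← h]
    refine card_bij (fun B _ => e B) (fun B hB => ?_) (fun B _ B' _ hBB' => e.injective hBB')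
      (fun l hl => ⟨e.symm l, ?_, e.apply_symm_apply l⟩)
    · simpa using hB
    · simpa using hl
  · intro B
    have h := ProjectivePlane.pointCount_eq (L := P) P (e B)
    rw [horder, Configuration.pointCount, Nat.card_eq_fintype_card, Fintype.card_subtype] at h
    rw [← h]
    refine card_bij (fun q _ => e q) (fun q hq => ?_) (fun q _ q' _ hqq' => e.injective hqq')
      (fun pt hpt => ⟨e.symm pt, ?_, e.apply_symm_apply pt⟩)
    · simpa using hq
    · simpa using hpt
  · intro q q' hqq'
    have hne : e q ≠ e q' := fun h => hqq' (e.injective h)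
    rw [card_eq_one]
    refine ⟨e.symm (HasLines.mkLine (L := P) hne), ?_⟩
    ext B
    simp only [mem_filter, mem_univ, true_and, mem_singleton]
    constructor
    · rintro ⟨h1, h2⟩
      have hax := HasLines.mkLine_ax (L := P) hne
      rcases Nondegenerate.eq_or_eq h1 h2 hax.1 hax.2 with h | h
      · exact absurd h hne
      · rw [← h, Equiv.symm_apply_apply]
    · rintro rfl
      simpa using HasLines.mkLine_ax (L := P) hne
  · intro B B' hBB'
    have hne : e B ≠ e B' := fun h => hBB' (e.injective h)
    rw [card_eq_one]
    refine ⟨e.symm (HasPoints.mkPoint (P := P) hne), ?_⟩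
    ext q
    simp only [mem_filter, mem_univ, true_and, mem_singleton]
    constructor
    · rintro ⟨h1, h2⟩
      have hax := HasPoints.mkPoint_ax (P := P) hne
      rcases Nondegenerate.eq_or_eq h1 hax.1 h2 hax.2 with h | h
      · rw [← h, Equiv.symm_apply_apply]
      · exact absurd h hne
    · rintro rfl
      simpa using HasPoints.mkPoint_ax (P := P) hne

end Prime

end Summit.PneNP.PneNP.Theorems.SosBlindPlanes
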